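import Summits.AnomalousDissipation.AnomalousDissipation.Theorems.MomentParityLevelNOrbit
import Summits.AnomalousDissipation.AnomalousDissipation.Theorems.MomentParityGalerkinLiouvilleTest
import Summits.AnomalousDissipation.AnomalousDissipation.Theorems.MomentParityPathSpace
import Literature.Analysis.FluidPDE.GalerkinInvariantMeasure

/-!
# Route MomentParity · `GalerkinEnsembleRealization` — the level-`N` ensemble as a shift-invariant
  law on the trajectory space

From the hypothesis of `GalerkinEnsembleRealization` at one level `N` (a probability measure `μ`
on `H` carried by band-limited fields of the ball `|u| ≤ R`, annihilating the Foias–Prodi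
generator on band-limited cylindrical tests) we build:

* the law `m = (u ↦ û|_S)_* μ` of the coefficients on the Galerkin phase space, carried by the
  compact part `K` of the energy ball, satisfying the Liouville equation of the Galerkin system
  (`MomentParityGalerkinLiouvilleTest`), hence **invariant under the Galerkin semiflow**
  (`Literature.Analysis.FluidPDE.map_galerkinCoeffFlow_eq_self`);
* a.e. confinement of the orbits to the energy ball, so that a.e. orbit path lies in the
  trajectory space `𝒦 = pathSpace R (pathLip ν A R)` (`MomentParityLevelNOrbit`);
* the law `P = (orbitPathOn)_* m` on `𝒦`, a probability measure **invariant under the shift**.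

(stmt-AnomalousDissipation-11466; Foias–Rosa–Temam 2013, proof of Thm. 3.1; FMRT 2001, Ch. IV
App. B.)
-/

noncomputable section

set_option linter.dupNamespace false

open MeasureTheory Set Filter Topology Function Metric
open scoped BigOperators InnerProductSpace RealInnerProductSpace

namespace Summit.AnomalousDissipation.AnomalousDissipation.Theorems.MomentParity

open Literature.Analysis.FunctionSpaces Literature.Analysis.FunctionSpaces.Torus
open Literature.Analysis.FluidPDE Literature.Analysis.FluidPDE.Torus

/-! ### The coefficient map and the law of the coefficients -/

/-- The coefficient map `u ↦ û|_S` is continuous on `H`. -/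
theorem continuous_fourierRestrict_coe (N : ℕ) :
    Continuous fun u : Torus.energySpace (Fin 3) => fourierRestrict (freqBall N) (u.1 : UnitAddTorus (Fin 3) → EuclideanSpace ℝ (Fin 3)) := by
  refine continuous_pi fun k => ?_
  exact (continuous_mFourierCoeff_complexify_coe (k : Fin 3 → ℤ)).comp continuous_subtype_val

/-- **Bessel in the ball**: for `u ∈ H` with `|u| ≤ R`, `∑_{k∈S} ‖(û|_S)‾ k‖² ≤ R²`. -/
theorem sum_norm_coeffExt_fourierRestrict_sq_le {N : ℕ} (u : Torus.energySpace (Fin 3)) {R : ℝ}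
    (hu : ‖u‖ ≤ R) :
    ∑ k ∈ freqBall N, ‖coeffExt (freqBall N) (fourierRestrict (freqBall N) (u.1 : UnitAddTorus (Fin 3) → EuclideanSpace ℝ (Fin 3))) k‖ ^ 2 ≤ R ^ 2 := by
  have h1 : ∑ k ∈ freqBall N, ‖coeffExt (freqBall N) (fourierRestrict (freqBall N) (u.1 : UnitAddTorus (Fin 3) → EuclideanSpace ℝ (Fin 3))) k‖ ^ 2 =
      ∑ k ∈ freqBall N, ‖(UnitAddTorus.mFourierCoeff (EuclideanSpace.complexify ∘ (u.1 : UnitAddTorus (Fin 3) → EuclideanSpace ℝ (Fin 3)))) k‖ ^ 2 :=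
    Finset.sum_congr rfl fun k hk => by rw [coeffExt_of_mem _ hk, fourierRestrict_apply]
  rw [h1]
  have h2 := sum_le_hasSum (freqBall N) (fun k _ => sq_nonneg _)
    (hasSum_sq_norm_mFourierCoeff_complexify (Lp.memLp u.1))
  have h3 : ∫ x, ‖(u.1 : UnitAddTorus (Fin 3) → EuclideanSpace ℝ (Fin 3)) x‖ ^ 2 = ‖u‖ ^ 2 := integral_norm_sq_coe_eq u.1
  have h4 : ‖u‖ ^ 2 ≤ R ^ 2 := by
    have h0 : 0 ≤ ‖u‖ := norm_nonneg _
    nlinarith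
  linarith

/-- **The compact carrier** of the law of the coefficients: the part of the energy ball
`∑_{k∈S} ‖c̄ k‖² ≤ R²` in the phase space. -/
theorem isCompact_galerkinBall (N : ℕ) (R : ℝ) :
    IsCompact {c : ↥(freqBall (d := Fin 3) N) → EuclideanSpace ℂ (Fin 3) | c ∈ galerkinSubspace (freqBall N) ∧
      ∑ k ∈ freqBall N, ‖coeffExt (freqBall N) c k‖ ^ 2 ≤ R ^ 2} := by
  have hclosed : IsClosed {c : ↥(freqBall (d := Fin 3) N) → EuclideanSpace ℂ (Fin 3) | c ∈ galerkinSubspace (freqBall N) ∧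
      ∑ k ∈ freqBall N, ‖coeffExt (freqBall N) c k‖ ^ 2 ≤ R ^ 2} := by
    have hc : Continuous fun c : ↥(freqBall (d := Fin 3) N) → EuclideanSpace ℂ (Fin 3) =>
        ∑ k ∈ freqBall N, ‖coeffExt (freqBall N) c k‖ ^ 2 := by
      refine continuous_finsetSum _ fun k hk => ?_
      simp_rw [coeffExt_of_mem _ hk]
      exact ((continuous_apply _).norm).pow 2
    rw [setOf_and]
    exact ((galerkinSubspace (freqBall N)).closed_of_finiteDimensional).inter (isClosed_le hc continuous_const)
  refine (isCompact_closedBall (0 : ↥(freqBall (d := Fin 3) N) → EuclideanSpace ℂ (Fin 3)) |R|).of_isClosed_subset hclosed fun c hc => ?_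
  rw [mem_closedBall, dist_zero_right, pi_norm_le_iff_of_nonneg (abs_nonneg R)]
  intro k
  have h := norm_coeffExt_le_of_sum_sq_le hc.2 k
  rwa [coeffExt_coe] at h

/-! ### The law of the coefficients: carrier, Liouville equation, invariance -/

section Law

variable {N : ℕ} {ν : ℝ} {f : UnitAddTorus (Fin 3) → EuclideanSpace ℝ (Fin 3)} {R A : ℝ} {μ : Measure (Torus.energySpace (Fin 3))}

/-- The law of the coefficients is carried by the compact part of the energy ball. -/
theorem map_coeff_compl_galerkinBall_eq_zero [IsProbabilityMeasure μ] (h2 : ∀ᵐ u ∂μ, ‖u‖ ≤ R) :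
    (μ.map fun u : Torus.energySpace (Fin 3) => fourierRestrict (freqBall N) (u.1 : UnitAddTorus (Fin 3) → EuclideanSpace ℝ (Fin 3)))
      {c | c ∈ galerkinSubspace (freqBall N) ∧
        ∑ k ∈ freqBall N, ‖coeffExt (freqBall N) c k‖ ^ 2 ≤ R ^ 2}ᶜ = 0 := by
  rw [Measure.map_apply (continuous_fourierRestrict_coe N).measurable
    (isCompact_galerkinBall N R).isClosed.measurableSet.compl, preimage_compl, ← mem_ae_iff]
  -- a.e. `u` has coefficients in the ball
  filter_upwards [h2] with u hu
  exact ⟨fourierRestrict_coe_mem_galerkinSubspace N u, sum_norm_coeffExt_fourierRestrict_sq_le u hu⟩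

/-- **The law of the coefficients satisfies the Liouville equation of the Galerkin system.** -/
theorem map_coeff_liouville [IsProbabilityMeasure μ] (hf : MemLp f 2 volume) (hf0 : Torus.HasZeroMean f)
    (h1 : ∀ᵐ u ∂μ, ∀ k ∉ (freqBall N).erase (0 : Fin 3 → ℤ), (UnitAddTorus.mFourierCoeff (EuclideanSpace.complexify ∘ (u.1 : UnitAddTorus (Fin 3) → EuclideanSpace ℝ (Fin 3)))) k = 0)
    (h2 : ∀ᵐ u ∂μ, ‖u‖ ≤ R)
    (h4 : ∀ Φ : CylindricalTest (Fin 3),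
      (∀ i, ∀ k ∉ (freqBall N).erase (0 : Fin 3 → ℤ), (UnitAddTorus.mFourierCoeff (EuclideanSpace.complexify ∘ (Φ.g i))) k = 0) →
        Integrable (fun u => nsGeneratorPairing ν f u (Φ.grad u)) μ ∧
          ∫ u, nsGeneratorPairing ν f u (Φ.grad u) ∂μ = 0)
    (ψ : (↥(freqBall (d := Fin 3) N) → EuclideanSpace ℂ (Fin 3)) → ℝ) (hψ : ContDiff ℝ 1 ψ)
    (_hψc : HasCompactSupport ψ) :
    ∫ c, fderiv ℝ ψ c (galerkinRHS (freqBall N) ν (fourierRestrict (freqBall N) f) c)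
      ∂(μ.map fun u : Torus.energySpace (Fin 3) => fourierRestrict (freqBall N) (u.1 : UnitAddTorus (Fin 3) → EuclideanSpace ℝ (Fin 3))) = 0 := by
  have hcont : Continuous fun c : ↥(freqBall (d := Fin 3) N) → EuclideanSpace ℂ (Fin 3) =>
      fderiv ℝ ψ c (galerkinRHS (freqBall N) ν (fourierRestrict (freqBall N) f) c) :=
    (hψ.continuous_fderiv one_ne_zero).clm_apply (contDiff_galerkinRHS ν _ (n := 1)).continuous
  rw [integral_map (continuous_fourierRestrict_coe N).measurable.aemeasurable hcont.aestronglyMeasurable]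
  exact (integral_fderiv_galerkinRHS_comp_eq_zero ν hf hf0 h1 h2 h4 hψ).2

/-- **The law of the coefficients is invariant under the Galerkin semiflow** (`ν > 0`). -/
theorem map_coeff_invariant [IsProbabilityMeasure μ] (hν : 0 < ν) (hf : MemLp f 2 volume)
    (hf0 : Torus.HasZeroMean f)
    (h1 : ∀ᵐ u ∂μ, ∀ k ∉ (freqBall N).erase (0 : Fin 3 → ℤ), (UnitAddTorus.mFourierCoeff (EuclideanSpace.complexify ∘ (u.1 : UnitAddTorus (Fin 3) → EuclideanSpace ℝ (Fin 3)))) k = 0)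
    (h2 : ∀ᵐ u ∂μ, ‖u‖ ≤ R)
    (h4 : ∀ Φ : CylindricalTest (Fin 3),
      (∀ i, ∀ k ∉ (freqBall N).erase (0 : Fin 3 → ℤ), (UnitAddTorus.mFourierCoeff (EuclideanSpace.complexify ∘ (Φ.g i))) k = 0) →
        Integrable (fun u => nsGeneratorPairing ν f u (Φ.grad u)) μ ∧
          ∫ u, nsGeneratorPairing ν f u (Φ.grad u) ∂μ = 0)
    {t : ℝ} (ht : 0 ≤ t) :
    (μ.map fun u : Torus.energySpace (Fin 3) => fourierRestrict (freqBall N) (u.1 : UnitAddTorus (Fin 3) → EuclideanSpace ℝ (Fin 3))).map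
        (galerkinCoeffFlow ν (fourierRestrict (freqBall N) f) t) =
      μ.map fun u : Torus.energySpace (Fin 3) => fourierRestrict (freqBall N) (u.1 : UnitAddTorus (Fin 3) → EuclideanSpace ℝ (Fin 3)) := by
  haveI : IsProbabilityMeasure (μ.map fun u : Torus.energySpace (Fin 3) =>
      fourierRestrict (freqBall N) (u.1 : UnitAddTorus (Fin 3) → EuclideanSpace ℝ (Fin 3))) :=
    Measure.isProbabilityMeasure_map (continuous_fourierRestrict_coe N).measurable.aemeasurable
  exact map_galerkinCoeffFlow_eq_self hν.le neg_mem_freqBall_of_mem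
    (isRealCoeff_mFourierCoeff (hf.integrable one_le_two)) (isCompact_galerkinBall N R)
    (fun c hc => hc.1) (map_coeff_compl_galerkinBall_eq_zero h2)
    (fun ψ hψ hψc => map_coeff_liouville hf hf0 h1 h2 h4 ψ hψ hψc) t ht

/-- **A.e. confinement of the orbits to the energy ball**: for `m`-a.e. datum `c` (of the phase
space) the whole orbit stays in the ball, `∑_{k∈S} ‖(φ_t c)‾ k‖² ≤ R²` for all `t ≥ 0` (invariance
at every rational time, continuity of the orbit, closedness of the ball). -/
theorem map_coeff_ae_confined [IsProbabilityMeasure μ] (hν : 0 < ν) (hf : MemLp f 2 volume)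
    (hf0 : Torus.HasZeroMean f)
    (h1 : ∀ᵐ u ∂μ, ∀ k ∉ (freqBall N).erase (0 : Fin 3 → ℤ), (UnitAddTorus.mFourierCoeff (EuclideanSpace.complexify ∘ (u.1 : UnitAddTorus (Fin 3) → EuclideanSpace ℝ (Fin 3)))) k = 0)
    (h2 : ∀ᵐ u ∂μ, ‖u‖ ≤ R)
    (h4 : ∀ Φ : CylindricalTest (Fin 3),
      (∀ i, ∀ k ∉ (freqBall N).erase (0 : Fin 3 → ℤ), (UnitAddTorus.mFourierCoeff (EuclideanSpace.complexify ∘ (Φ.g i))) k = 0) →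
        Integrable (fun u => nsGeneratorPairing ν f u (Φ.grad u)) μ ∧
          ∫ u, nsGeneratorPairing ν f u (Φ.grad u) ∂μ = 0) :
    ∀ᵐ c ∂(μ.map fun u : Torus.energySpace (Fin 3) => fourierRestrict (freqBall N) (u.1 : UnitAddTorus (Fin 3) → EuclideanSpace ℝ (Fin 3))),
      c ∈ galerkinSubspace (freqBall N) ∧
        ∀ t, 0 ≤ t → ∑ k ∈ freqBall N,
          ‖coeffExt (freqBall N) (galerkinCoeffFlow ν (fourierRestrict (freqBall N) f) t c) k‖ ^ 2 ≤ R ^ 2 := by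
  set κ := fun u : Torus.energySpace (Fin 3) => fourierRestrict (freqBall N) (u.1 : UnitAddTorus (Fin 3) → EuclideanSpace ℝ (Fin 3)) with hκ
  set gN := fourierRestrict (freqBall N) f with hgN
  set B := {c : ↥(freqBall (d := Fin 3) N) → EuclideanSpace ℂ (Fin 3) | c ∈ galerkinSubspace (freqBall N) ∧
      ∑ k ∈ freqBall N, ‖coeffExt (freqBall N) c k‖ ^ 2 ≤ R ^ 2} with hB
  have hBc : IsClosed B := (isCompact_galerkinBall N R).isClosed
  have hκm : AEMeasurable κ μ := (continuous_fourierRestrict_coe N).measurable.aemeasurable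
  haveI : IsProbabilityMeasure (μ.map κ) := Measure.isProbabilityMeasure_map hκm
  have hS : ∀ k ∈ freqBall (d := Fin 3) N, -k ∈ freqBall (d := Fin 3) N := neg_mem_freqBall_of_mem
  have hgr : IsRealCoeff gN := isRealCoeff_mFourierCoeff (hf.integrable one_le_two)
  have hBnull : (μ.map κ) Bᶜ = 0 := map_coeff_compl_galerkinBall_eq_zero h2
  -- a.e. in the phase space
  have hV : ∀ᵐ c ∂(μ.map κ), c ∈ galerkinSubspace (freqBall N) := by
    have : ∀ᵐ c ∂(μ.map κ), c ∈ B := by rw [ae_iff]; exact hBnull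
    exact this.mono fun c hc => hc.1
  -- a.e., the orbit is in the ball at every rational time
  have hrat : ∀ q : ℚ, 0 ≤ q → ∀ᵐ c ∂(μ.map κ), galerkinCoeffFlow ν gN q c ∈ B := by
    intro q hq
    have hq' : (0 : ℝ) ≤ q := by exact_mod_cast hq
    have hinv := map_coeff_invariant hν hf hf0 h1 h2 h4 hq'
    have hφm : AEMeasurable (galerkinCoeffFlow ν gN q) (μ.map κ) := by
      set V : Set (↥(freqBall (d := Fin 3) N) → EuclideanSpace ℂ (Fin 3)) :=
        ((galerkinSubspace (freqBall (d := Fin 3) N) : Submodule ℝ (↥(freqBall (d := Fin 3) N) → EuclideanSpace ℂ (Fin 3))) :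
          Set (↥(freqBall (d := Fin 3) N) → EuclideanSpace ℂ (Fin 3))) with hVdef
      have hcont : ContinuousOn (fun c => galerkinCoeffFlow ν gN q c) V :=
        (continuousOn_galerkinCoeffFlow hν.le hS hgr).comp (continuousOn_const.prodMk continuousOn_id)
          fun c hc => ⟨mem_Ici.2 hq', hc⟩
      have hres : (μ.map κ).restrict V = μ.map κ := Measure.restrict_eq_self_of_ae_mem hV
      rw [← hres]
      exact hcont.aemeasurable (galerkinSubspace (freqBall N)).closed_of_finiteDimensional.measurableSet
    rw [ae_iff]
    have h := Measure.map_apply_of_aemeasurable hφm hBc.measurableSet.compl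
    rw [hinv] at h
    rw [show {a | ¬galerkinCoeffFlow ν gN (q : ℝ) a ∈ B} = galerkinCoeffFlow ν gN q ⁻¹' Bᶜ from rfl, ← h]
    exact hBnull
  have hrat' : ∀ᵐ c ∂(μ.map κ), ∀ q : ℚ, 0 ≤ q → galerkinCoeffFlow ν gN q c ∈ B := by
    rw [ae_all_iff]
    intro q
    by_cases hq : 0 ≤ q
    · exact (hrat q hq).mono fun c hc _ => hc
    · exact ae_of_all _ fun c hq' => absurd hq' hq
  -- from rational to real times by continuity of the orbit
  filter_upwards [hV, hrat'] with c hcV hc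
  refine ⟨hcV, fun t ht => ?_⟩
  have hsol := isGalerkinODESolution_galerkinCoeffFlow hν.le hS hgr hcV
  have hcont : ContinuousWithinAt (fun s => galerkinCoeffFlow ν gN s c) (Ici 0) t :=
    hsol.continuousOn t (mem_Ici.2 ht)
  have hdy : Tendsto (fun n => ((dyadicFloor t n : ℚ) : ℝ)) atTop (𝓝[Ici 0] t) := by
    refine tendsto_nhdsWithin_iff.2 ⟨?_, Eventually.of_forall fun n => ?_⟩
    · simpa [max_eq_left ht] using tendsto_dyadicFloor t
    · exact mem_Ici.2 (by exact_mod_cast dyadicFloor_nonneg t n)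
  have hlim : Tendsto (fun n => galerkinCoeffFlow ν gN ((dyadicFloor t n : ℚ) : ℝ) c) atTop
      (𝓝 (galerkinCoeffFlow ν gN t c)) := hcont.tendsto.comp hdy
  exact (hBc.mem_of_tendsto hlim (Eventually.of_forall fun n => hc _ (dyadicFloor_nonneg t n))).2

/-- **A.e. orbit path lies in the trajectory space**: the good set
`C = {c ∈ V | orbitPath c ∈ 𝒦(R, pathLip ν A R)}` carries the law of the coefficients
(`A ≥ ‖f̂(k)‖` for all `k`, `A ≥ 0`). -/
theorem map_coeff_compl_good_eq_zero [IsProbabilityMeasure μ] (hν : 0 < ν) (hf : MemLp f 2 volume)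
    (hf0 : Torus.HasZeroMean f)
    (hA : ∀ k, ‖coeffExt (freqBall N) (fourierRestrict (freqBall N) f) k‖ ≤ A) (hA0 : 0 ≤ A)
    (h1 : ∀ᵐ u ∂μ, ∀ k ∉ (freqBall N).erase (0 : Fin 3 → ℤ), (UnitAddTorus.mFourierCoeff (EuclideanSpace.complexify ∘ (u.1 : UnitAddTorus (Fin 3) → EuclideanSpace ℝ (Fin 3)))) k = 0)
    (h2 : ∀ᵐ u ∂μ, ‖u‖ ≤ R)
    (h4 : ∀ Φ : CylindricalTest (Fin 3),
      (∀ i, ∀ k ∉ (freqBall N).erase (0 : Fin 3 → ℤ), (UnitAddTorus.mFourierCoeff (EuclideanSpace.complexify ∘ (Φ.g i))) k = 0) →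
        Integrable (fun u => nsGeneratorPairing ν f u (Φ.grad u)) μ ∧
          ∫ u, nsGeneratorPairing ν f u (Φ.grad u) ∂μ = 0) :
    (μ.map fun u : Torus.energySpace (Fin 3) => fourierRestrict (freqBall N) (u.1 : UnitAddTorus (Fin 3) → EuclideanSpace ℝ (Fin 3)))
      {c | c ∈ galerkinSubspace (freqBall N) ∧
        orbitPath ν (fourierRestrict (freqBall N) f) c ∈ pathSpace R (pathLip ν A R)}ᶜ = 0 := by
  have h : ∀ᵐ c ∂(μ.map fun u : Torus.energySpace (Fin 3) => fourierRestrict (freqBall N) (u.1 : UnitAddTorus (Fin 3) → EuclideanSpace ℝ (Fin 3))),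
      c ∈ {c | c ∈ galerkinSubspace (freqBall N) ∧
        orbitPath ν (fourierRestrict (freqBall N) f) c ∈ pathSpace R (pathLip ν A R)} := by
    filter_upwards [map_coeff_ae_confined hν hf hf0 h1 h2 h4] with c hc
    exact ⟨hc.1, orbitPath_mem_pathSpace hν.le neg_mem_freqBall_of_mem
      (isRealCoeff_mFourierCoeff (hf.integrable one_le_two)) hc.1 hA hA0 hc.2⟩
  rw [ae_iff] at h
  exact h

end Law

/-! ### The law on the trajectory space and its shift invariance -/

section PathLaw

variable {N : ℕ} {ν : ℝ} {g : ↥(freqBall (d := Fin 3) N) → EuclideanSpace ℂ (Fin 3)} {R : ℝ}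
  {L : (Fin 3 → ℤ) → ℝ}

/-- The good set is closed (continuity of the orbit map on the closed phase space, closedness of
the trajectory space). -/
theorem isClosed_good (hν : 0 ≤ ν) (hg : IsRealCoeff g) :
    IsClosed {c : ↥(freqBall (d := Fin 3) N) → EuclideanSpace ℂ (Fin 3) | c ∈ galerkinSubspace (freqBall N) ∧
      orbitPath ν g c ∈ pathSpace R L} :=
  (continuousOn_orbitPath hν neg_mem_freqBall_of_mem hg).preimage_isClosed_of_isClosed
    (galerkinSubspace (freqBall N)).closed_of_finiteDimensional (isClosed_pathSpace R L)

/-- **The corestricted orbit map is continuous on the good set.** -/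
theorem continuousOn_orbitPathOn (hν : 0 ≤ ν) (hg : IsRealCoeff g) (ω₀ : ↥(pathSpace (d := Fin 3) R L)) :
    ContinuousOn (orbitPathOn ν g R L ω₀)
      {c | c ∈ galerkinSubspace (freqBall N) ∧ orbitPath ν g c ∈ pathSpace R L} := by
  rw [continuousOn_iff_continuous_restrict]
  have h1 : Continuous fun c : ↥{c : ↥(freqBall (d := Fin 3) N) → EuclideanSpace ℂ (Fin 3) |
      c ∈ galerkinSubspace (freqBall N) ∧ orbitPath ν g c ∈ pathSpace R L} => orbitPath ν g c.1 :=
    (continuousOn_orbitPath hν neg_mem_freqBall_of_mem hg).comp_continuous continuous_subtype_val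
      fun c => c.2.1
  have h2 : Continuous fun c : ↥{c : ↥(freqBall (d := Fin 3) N) → EuclideanSpace ℂ (Fin 3) |
      c ∈ galerkinSubspace (freqBall N) ∧ orbitPath ν g c ∈ pathSpace R L} =>
      (⟨orbitPath ν g c.1, c.2.2⟩ : ↥(pathSpace (d := Fin 3) R L)) := h1.subtype_mk _
  refine h2.congr fun c => ?_
  simp only [restrict_apply, orbitPathOn, dif_pos c.2.2]

/-- **The corestricted orbit map is a.e. measurable** for every finite measure carried by the
good set. -/
theorem aemeasurable_orbitPathOn (hν : 0 ≤ ν) (hg : IsRealCoeff g) (ω₀ : ↥(pathSpace (d := Fin 3) R L))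
    {m : Measure (↥(freqBall (d := Fin 3) N) → EuclideanSpace ℂ (Fin 3))}
    (hm : m {c | c ∈ galerkinSubspace (freqBall N) ∧ orbitPath ν g c ∈ pathSpace R L}ᶜ = 0) :
    AEMeasurable (orbitPathOn ν g R L ω₀) m := by
  have hres : m.restrict {c | c ∈ galerkinSubspace (freqBall N) ∧ orbitPath ν g c ∈ pathSpace R L} = m :=
    Measure.restrict_eq_self_of_ae_mem (by rw [ae_iff]; exact hm)
  rw [← hres]
  exact (continuousOn_orbitPathOn hν hg ω₀).aemeasurable (isClosed_good hν hg).measurableSet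

/-- **The law on the trajectory space is shift invariant**: if `m` is invariant under the
time-one map of the Galerkin semiflow and carried by the good set, then `P = (orbitPathOn)_* m`
satisfies `θ_* P = P` (semigroup law `orbitPath (φ₁ c) = θ (orbitPath c)`). -/
theorem map_pathShiftOn_map_orbitPathOn (hν : 0 ≤ ν) (hg : IsRealCoeff g) (ω₀ : ↥(pathSpace (d := Fin 3) R L))
    {m : Measure (↥(freqBall (d := Fin 3) N) → EuclideanSpace ℂ (Fin 3))} [IsFiniteMeasure m]
    (hm : m {c | c ∈ galerkinSubspace (freqBall N) ∧ orbitPath ν g c ∈ pathSpace R L}ᶜ = 0)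
    (hinv : m.map (galerkinCoeffFlow ν g 1) = m) :
    (m.map (orbitPathOn ν g R L ω₀)).map (pathShiftOn R L (pathShift_mapsTo R L)) =
      m.map (orbitPathOn ν g R L ω₀) := by
  have hS : ∀ k ∈ freqBall (d := Fin 3) N, -k ∈ freqBall (d := Fin 3) N := neg_mem_freqBall_of_mem
  have hPi : AEMeasurable (orbitPathOn ν g R L ω₀) m := aemeasurable_orbitPathOn hν hg ω₀ hm
  have hθ : Measurable (pathShiftOn (d := Fin 3) R L (pathShift_mapsTo R L)) :=
    (continuous_pathShiftOn R L).measurable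
  have hφ : AEMeasurable (galerkinCoeffFlow ν g 1) m := by
    set V : Set (↥(freqBall (d := Fin 3) N) → EuclideanSpace ℂ (Fin 3)) :=
      ((galerkinSubspace (freqBall (d := Fin 3) N) : Submodule ℝ (↥(freqBall (d := Fin 3) N) → EuclideanSpace ℂ (Fin 3))) :
        Set (↥(freqBall (d := Fin 3) N) → EuclideanSpace ℂ (Fin 3))) with hVdef
    have hcont : ContinuousOn (fun c => galerkinCoeffFlow ν g 1 c) V :=
      (continuousOn_galerkinCoeffFlow hν hS hg).comp (continuousOn_const.prodMk continuousOn_id)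
        fun c hc => ⟨mem_Ici.2 zero_le_one, hc⟩
    have hV : ∀ᵐ c ∂m, c ∈ V := by
      have : ∀ᵐ c ∂m, c ∈ {c | c ∈ galerkinSubspace (freqBall N) ∧ orbitPath ν g c ∈ pathSpace R L} := by
        rw [ae_iff]; exact hm
      exact this.mono fun c hc => hc.1
    rw [← Measure.restrict_eq_self_of_ae_mem hV]
    exact hcont.aemeasurable (galerkinSubspace (freqBall N)).closed_of_finiteDimensional.measurableSet
  -- `θ ∘ Π = Π ∘ φ₁` a.e.
  have hae : (pathShiftOn R L (pathShift_mapsTo R L)) ∘ (orbitPathOn ν g R L ω₀) =ᵐ[m]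
      (orbitPathOn ν g R L ω₀) ∘ (galerkinCoeffFlow ν g 1) := by
    have hgood : ∀ᵐ c ∂m, c ∈ {c | c ∈ galerkinSubspace (freqBall N) ∧ orbitPath ν g c ∈ pathSpace R L} := by
      rw [ae_iff]; exact hm
    filter_upwards [hgood] with c hc
    have h1 : orbitPath ν g (galerkinCoeffFlow ν g 1 c) ∈ pathSpace R L := by
      rw [orbitPath_galerkinCoeffFlow_one hν hS hg hc.1]; exact pathShift_mem hc.2
    apply Subtype.ext
    simp only [comp_apply, coe_pathShiftOn_apply, coe_orbitPathOn_of_mem _ _ _ _ _ hc.2,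
      coe_orbitPathOn_of_mem _ _ _ _ _ h1, orbitPath_galerkinCoeffFlow_one hν hS hg hc.1]
  rw [AEMeasurable.map_map_of_aemeasurable hθ.aemeasurable hPi, Measure.map_congr hae]
  have hPi' : AEMeasurable (orbitPathOn ν g R L ω₀) (m.map (galerkinCoeffFlow ν g 1)) := by rwa [hinv]
  rw [← AEMeasurable.map_map_of_aemeasurable hPi' hφ, hinv]

end PathLaw


end Summit.AnomalousDissipation.AnomalousDissipation.Theorems.MomentParity
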